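import Summits.BirchSwinnertonDyer.Rank1Residual.Additive.X4RankZeroVisibleRefinedCertificateSharp
import Summits.BirchSwinnertonDyer.Rank1Residual.Additive.X4RankZeroVisibleLowerBoundPlacesSix
import HarnessLib

/-!
# The rank-two (G) visibility END over the SHARP Kato reading — Tamagawa READING and Tamagawa
# DEFECT `≤ 1` — and its prime-list record sockets
# (cell `b2b-bsdres`, team n1011, row T-GSHARP FILE 4; seat p04 GEN 12; sharp twins of n1011-p03's
# `X4RankZero.bsdp_of_congr_of_rank_two_of_kato` (`X4RankZeroVisibleLowerBound.lean`) and of n1011-p18's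
# adapter `…_of_kato_of_primeList` (`X4RankZeroVisibleLowerBoundPrimeList.lean`); route planner 1 ST-51c)

HONEST FRAMING (cell `b2b-bsdres`, run/shared/lean/b2b/bsd-rank1-residual/, verbatim in every
file): the goal of the cell is to DELETE the COMBINATION-SHAPED residual classes of the
Birch–Swinnerton-Dyer formula for ALL analytic-rank `≤ 1` elliptic curves over `ℚ` — "full BSD
formula for every rank `≤ 1` curve in class `C`" assembled STRICTLY from published theorems — so
that the rank-`≤ 1` remainder becomes exactly the CONSTRUCTION-SHAPED classes, which are TYPED
(missing-input `Prop`s), NOT attempted. This is not "finishing BSD". Team n1011 (N10 / N11, the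
additive block X4 ∧ `p = 3`): research route on the CONSTRUCTION-SHAPED class X4; no claim beyond
the stated classes; nothing is booked; no mark / label / count is changed by this file. Theorems
only (no definition, no new named fact, no `sorry`). END theorems: CONDITIONAL on the displayed
named facts (`hKatoS`, `hCT`, `hGZK`, `hmod`); they CLOSE NOTHING by themselves — a per-row RECORD
discharges `θ`, `hrank`, the place list, `hloc` and the Tamagawa reading / defect in the kernel, and
carries `hr`, `hq`/`hv`/`hev`, `D`/`hc` as EVIDENCE / displayed binders (n1011 lead R5-82 (d)).

## What

n1011-p03's `X4RankZero.bsdp_of_congr_of_rank_two_of_kato` (every odd `p`; the K42 / K43 / PASS-rank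
roads of route planner 1: a `p`-congruent partner of rank `≥ 2` with `E′(ℚ_v)[p] = 0` at every place
of `S`, no paid place) binds Kato's ORIGINAL reading with `htam : ¬ p ∣ ∏ c_ℓ`. Exactly as FILE 1 does
for the refined seven-kind certificate, this file composes the SAME visible lower half
(`exists_sha_ne_zero_of_congr_of_rank` → `dvd_shaOrder_of_exists_torsion` → Cassels–Tate) with the
SHARP upper halves of FILE 1 §1 (§0: the kind-agnostic form over ANY visible element of `Ш(E)[p]`,
sharp twins of n1011-p14's `X4RankZero.bsdp_of_exists_sha_torsion_of_kato` — the END the D44-K (G)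
records over n1011-p10's identity-component lower half take):
* `X4RankZero.bsdp_of_congr_of_rank_two_of_katoSharp` — Tamagawa READING
  `ord_p ∏ c_ℓ = ord_p c(W/ℚ_[p])` (every odd `p`);
* `X4RankZero.bsdp_of_congr_of_rank_two_of_katoSharp_of_tamDefect_le_one` — DEFECT `≤ 1` with
  `hev : Even (ord_p #Ш_an)` (every odd `p`);
* `…_of_primeList` twins of both (`S` = the places over a list `L ∋ p` supporting both integral
  discriminants; n1011-p18's adapter shape token for token, with `hKato ↦ hKatoS`, `htam` retyped,
  `hev` inserted after `hv` in the defect twin).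
At `p = 3` the census of `HOME/b2b-bsdres-n1011-p04/gen12/census/gsharp_defect_rows.tsv` (EVIDENCE)
reads: K42 45 → 21 reading · 21 defect-one · 3 neither; K43 39 → 39 reading; PASS 196 → 77 · 101 · 18.

References: [CremonaMazur2000] §3 and Table 1; [AgasheStein2002] Thm. 3.1; [Kato2004Asterisque]
Thm. 14.5 (3), Prop. 14.16 (2); [Kim2022StructureSelmer] §3.2.3; [SilvermanAEC2009] VII.5.1, X.4.14;
[Miller2011LMS] Def. 1.1; cells/n1011/ROUTE-1.md §41.5, §51 (ST-51c).
-/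

set_option autoImplicit false

noncomputable section

open scoped Classical NumberField
open IsDedekindDomain NumberField WeierstrassCurve Rat.HeightOneSpectrum
  Literature.NumberTheory.EllipticCurves Literature.NumberTheory.EllipticCurves.ModularForms
  Literature.NumberTheory.EllipticCurves.Rank1Residual
  Literature.NumberTheory.EllipticCurves.Rank1Residual.Typed
  Literature.NumberTheory.GaloisRepresentations

namespace Summit.BirchSwinnertonDyer.Rank1Residual.Additive

/-! ### §0. Kind-agnostic form: `BSD(E,p)` from ANY visible element of `Ш(E)[p]`, sharp upper halves -/

/-- **X4 ∧ `r = 0`, potentially GOOD at an odd `p`, tower onto, Tamagawa READING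
`ord_p ∏ c_ℓ = ord_p c_p`, a parametrisation datum with `p ∤ c_D`, `ord_p #Ш_an ≤ 2`: `BSD(E,p)` from
ANY visible element of `Ш(E)[p]`** (sharp twin of n1011-p14's `X4RankZero.bsdp_of_exists_sha_torsion_of_kato`,
`X4RankZeroVisibleLowerBoundPlacesSix.lean`; the socket every LOWER-half producer — places, rank,
identity-component index — can end in): `dvd_shaOrder_of_exists_torsion` → Cassels–Tate
(`missingLowerBoundAt_of_casselsTate_of_pow_dvd`, `k = 1`) → `X4RankZero.bsdp_of_missingLowerBoundAt_of_katoSharp`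
(FILE 1). [cite: Kato2004Asterisque, Thm. 14.5 (3) (p. 236), Prop. 14.16 (2) (p. 244)] [cite: SilvermanAEC2009, Thm. X.4.14] -/
theorem X4RankZero.bsdp_of_exists_sha_torsion_of_katoSharp
    (hKatoS : Kato2004.rankZero_padicValNat_sha_le_sub_localTamagawa_of_additive_potGood_of_imageContainsSL2)
    (hCT : exists_casselsTate_pairing (K := ℚ))
    (hGZK : rank_eq_analyticRank_of_analyticRank_le_one) (hmod : hasEntireLFunction_rat)
    (W : WeierstrassCurve ℚ) [W.IsElliptic] [W.IsGloballyMinimal] (p : ℕ) [Fact p.Prime]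
    (hr : W.analyticRank = 0) (hX : ClassX4 W p) (hpot : 0 ≤ padicValRat p W.j)
    (hsurj : ∀ n : ℕ, W.HasSurjectiveModNGaloisRep (p ^ n : ℕ))
    (htam : padicValNat p W.tamagawaProduct =
      padicValNat p ((W.baseChange ℚ_[p]).localTamagawaNumber ℤ_[p]))
    {N : ℕ} [NeZero N] (D : ModularParametrizationData W N) (hc : ¬ (p : ℤ) ∣ D.maninConstant)
    {q : ℚ} (hq : shaAn W = (q : ℂ)) (hv : padicValRat p q ≤ 2)
    (hvis : ∃ c : W.sha, c ≠ 0 ∧ p • c = 0) :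
    BSDp W p := by
  have hlow : MissingLowerBoundAt W p :=
    missingLowerBoundAt_of_casselsTate_of_pow_dvd W p hCT (hGZK W (by omega)).2 hq (k := 1)
      (by simpa using hv) (by simpa using dvd_shaOrder_of_exists_torsion W p hvis)
  exact X4RankZero.bsdp_of_missingLowerBoundAt_of_katoSharp W p hKatoS hGZK hmod hr hX hpot hsurj htam D hc
    hlow

/-- **X4 ∧ `r = 0`, potentially GOOD at an odd `p`, tower onto, Tamagawa DEFECT `≤ 1`, a
parametrisation datum with `p ∤ c_D`, `ord_p #Ш_an ≤ 2` and EVEN: `BSD(E,p)` from ANY visible element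
of `Ш(E)[p]`** (as `X4RankZero.bsdp_of_exists_sha_torsion_of_katoSharp`, reading relaxed to defect
`≤ 1`, `hev : Even (ord_p q)` inserted after `hv`; upper half
`X4RankZero.bsdp_of_missingLowerBoundAt_of_katoSharp_of_casselsTate_of_tamDefect_le_one`, FILE 1). The
18 D44-K potentially good rows of route planner 1 (all of defect one, census EVIDENCE) end here over
n1011-p10's identity-component lower half. [cite: Kato2004Asterisque, Thm. 14.5 (3) (p. 236), Prop. 14.16 (2) (p. 244)]
[cite: SilvermanAEC2009, Thm. X.4.14] -/
theorem X4RankZero.bsdp_of_exists_sha_torsion_of_katoSharp_of_tamDefect_le_one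
    (hKatoS : Kato2004.rankZero_padicValNat_sha_le_sub_localTamagawa_of_additive_potGood_of_imageContainsSL2)
    (hCT : exists_casselsTate_pairing (K := ℚ))
    (hGZK : rank_eq_analyticRank_of_analyticRank_le_one) (hmod : hasEntireLFunction_rat)
    (W : WeierstrassCurve ℚ) [W.IsElliptic] [W.IsGloballyMinimal] (p : ℕ) [Fact p.Prime]
    (hr : W.analyticRank = 0) (hX : ClassX4 W p) (hpot : 0 ≤ padicValRat p W.j)
    (hsurj : ∀ n : ℕ, W.HasSurjectiveModNGaloisRep (p ^ n : ℕ))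
    (htam : padicValNat p W.tamagawaProduct ≤
      padicValNat p ((W.baseChange ℚ_[p]).localTamagawaNumber ℤ_[p]) + 1)
    {N : ℕ} [NeZero N] (D : ModularParametrizationData W N) (hc : ¬ (p : ℤ) ∣ D.maninConstant)
    {q : ℚ} (hq : shaAn W = (q : ℂ)) (hv : padicValRat p q ≤ 2) (hev : Even (padicValRat p q))
    (hvis : ∃ c : W.sha, c ≠ 0 ∧ p • c = 0) :
    BSDp W p := by
  have hlow : MissingLowerBoundAt W p :=
    missingLowerBoundAt_of_casselsTate_of_pow_dvd W p hCT (hGZK W (by omega)).2 hq (k := 1)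
      (by simpa using hv) (by simpa using dvd_shaOrder_of_exists_torsion W p hvis)
  exact X4RankZero.bsdp_of_missingLowerBoundAt_of_katoSharp_of_casselsTate_of_tamDefect_le_one W p hCT
    hKatoS hGZK hmod hr hX hpot hsurj htam D hc hq hev hlow

/-! ### §1. The rank-two END over the sharp upper halves, every odd `p` -/

/-- **X4 ∧ `r = 0`, potentially GOOD at an odd `p`, Tamagawa READING `ord_p ∏ c_ℓ = ord_p c_p`,
`ord_p #Ш_an ≤ 2`: `BSD(E,p)` from the SHARP Kato upper half and a VISIBLE element of `Ш(E)[p]` supplied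
by a `p`-congruent curve of rank `≥ 2`** — n1011-p03's `X4RankZero.bsdp_of_congr_of_rank_two_of_kato`
with `hKato ↦ hKatoS` and `htam` retyped to the reading (the `c_p`-only rows are served); composition
`exists_sha_ne_zero_of_congr_of_rank` → `dvd_shaOrder_of_exists_torsion` → Cassels–Tate →
`X4RankZero.bsdp_of_missingLowerBoundAt_of_katoSharp` (FILE 1). [cite: CremonaMazur2000, §3 and Table 1]
[cite: AgasheStein2002, Thm. 3.1] [cite: Kato2004Asterisque, Thm. 14.5 (3) (p. 236), Prop. 14.16 (2) (p. 244)]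
[cite: SilvermanAEC2009, Thm. X.4.14] -/
theorem X4RankZero.bsdp_of_congr_of_rank_two_of_katoSharp
    (hKatoS : Kato2004.rankZero_padicValNat_sha_le_sub_localTamagawa_of_additive_potGood_of_imageContainsSL2)
    (hCT : exists_casselsTate_pairing (K := ℚ))
    (hGZK : rank_eq_analyticRank_of_analyticRank_le_one) (hmod : hasEntireLFunction_rat)
    (W : WeierstrassCurve ℚ) [W.IsElliptic] [W.IsGloballyMinimal] (p : ℕ) [Fact p.Prime] (hp : p ≠ 2)
    (hr : W.analyticRank = 0) (hX : ClassX4 W p) (hpot : 0 ≤ padicValRat p W.j)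
    (hsurj : ∀ n : ℕ, W.HasSurjectiveModNGaloisRep (p ^ n : ℕ))
    (htam : padicValNat p W.tamagawaProduct =
      padicValNat p ((W.baseChange ℚ_[p]).localTamagawaNumber ℤ_[p]))
    {N : ℕ} [NeZero N] (D : ModularParametrizationData W N) (hc : ¬ (p : ℤ) ∣ D.maninConstant)
    {q : ℚ} (hq : shaAn W = (q : ℂ)) (hv : padicValRat p q ≤ 2)
    (W' : WeierstrassCurve ℚ) [W'.IsElliptic]
    (θ : geomTorsion W' (p : ℤ) ≃+ geomTorsion W (p : ℤ))
    (hθ : ∀ (σ : Field.absoluteGaloisGroup ℚ) (P : geomTorsion W' (p : ℤ)), θ (σ • P) = σ • θ P)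
    (hrank : 2 ≤ W'.mordellWeilRank) (S : Finset (HeightOneSpectrum (𝓞 ℚ)))
    (hS : ∀ v : HeightOneSpectrum (𝓞 ℚ), v ∉ S →
      W.HasGoodReductionAt v ∧ W'.HasGoodReductionAt v ∧ (p : 𝓞 ℚ) ∉ v.asIdeal)
    (hloc : ∀ v ∈ S, Nat.card (nsmulAddMonoidHom p :
      (W'.baseChange (v.adicCompletion ℚ)).toAffine.Point →+ _).ker = 1) :
    BSDp W p := by
  haveI : Finite W.toAffine.Point := finite_point_of_analyticRank_eq_zero W hGZK hr
  have hirr : Irr W p :=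
    hasIrreducibleModPGaloisRep_of_hasSurjectiveModNGaloisRep W p (by simpa using hsurj 1)
  have hrank' : Module.finrank ℚ ℚ + 1 ≤ W'.mordellWeilRank := by rwa [Module.finrank_self]
  have hvis := W.exists_sha_ne_zero_of_congr_of_rank W' hp θ hθ S hS ‹_›
    (coprime_natCard_point_of_irr W p hirr) hrank' hloc
  have hlow : MissingLowerBoundAt W p :=
    missingLowerBoundAt_of_casselsTate_of_pow_dvd W p hCT (hGZK W (by omega)).2 hq (k := 1)
      (by simpa using hv) (by simpa using dvd_shaOrder_of_exists_torsion W p hvis)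
  exact X4RankZero.bsdp_of_missingLowerBoundAt_of_katoSharp W p hKatoS hGZK hmod hr hX hpot hsurj htam D hc
    hlow

/-- **X4 ∧ `r = 0`, potentially GOOD at an odd `p`, Tamagawa DEFECT `≤ 1`
(`ord_p ∏ c_ℓ ≤ ord_p c_p + 1`), `ord_p #Ш_an ≤ 2` and EVEN: `BSD(E,p)` from the SHARP Kato upper
half, Cassels–Tate parity, and a VISIBLE element of `Ш(E)[p]` supplied by a `p`-congruent curve of rank
`≥ 2`** — as `X4RankZero.bsdp_of_congr_of_rank_two_of_katoSharp` with the reading relaxed to defect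
`≤ 1` and ONE extra EVIDENCE binder `hev : Even (ord_p q)` inserted after `hv`; upper half
`X4RankZero.bsdp_of_missingLowerBoundAt_of_katoSharp_of_casselsTate_of_tamDefect_le_one` (FILE 1).
[cite: CremonaMazur2000, §3 and Table 1] [cite: AgasheStein2002, Thm. 3.1]
[cite: Kato2004Asterisque, Thm. 14.5 (3) (p. 236), Prop. 14.16 (2) (p. 244)] [cite: SilvermanAEC2009, Thm. X.4.14] -/
theorem X4RankZero.bsdp_of_congr_of_rank_two_of_katoSharp_of_tamDefect_le_one
    (hKatoS : Kato2004.rankZero_padicValNat_sha_le_sub_localTamagawa_of_additive_potGood_of_imageContainsSL2)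
    (hCT : exists_casselsTate_pairing (K := ℚ))
    (hGZK : rank_eq_analyticRank_of_analyticRank_le_one) (hmod : hasEntireLFunction_rat)
    (W : WeierstrassCurve ℚ) [W.IsElliptic] [W.IsGloballyMinimal] (p : ℕ) [Fact p.Prime] (hp : p ≠ 2)
    (hr : W.analyticRank = 0) (hX : ClassX4 W p) (hpot : 0 ≤ padicValRat p W.j)
    (hsurj : ∀ n : ℕ, W.HasSurjectiveModNGaloisRep (p ^ n : ℕ))
    (htam : padicValNat p W.tamagawaProduct ≤
      padicValNat p ((W.baseChange ℚ_[p]).localTamagawaNumber ℤ_[p]) + 1)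
    {N : ℕ} [NeZero N] (D : ModularParametrizationData W N) (hc : ¬ (p : ℤ) ∣ D.maninConstant)
    {q : ℚ} (hq : shaAn W = (q : ℂ)) (hv : padicValRat p q ≤ 2) (hev : Even (padicValRat p q))
    (W' : WeierstrassCurve ℚ) [W'.IsElliptic]
    (θ : geomTorsion W' (p : ℤ) ≃+ geomTorsion W (p : ℤ))
    (hθ : ∀ (σ : Field.absoluteGaloisGroup ℚ) (P : geomTorsion W' (p : ℤ)), θ (σ • P) = σ • θ P)
    (hrank : 2 ≤ W'.mordellWeilRank) (S : Finset (HeightOneSpectrum (𝓞 ℚ)))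
    (hS : ∀ v : HeightOneSpectrum (𝓞 ℚ), v ∉ S →
      W.HasGoodReductionAt v ∧ W'.HasGoodReductionAt v ∧ (p : 𝓞 ℚ) ∉ v.asIdeal)
    (hloc : ∀ v ∈ S, Nat.card (nsmulAddMonoidHom p :
      (W'.baseChange (v.adicCompletion ℚ)).toAffine.Point →+ _).ker = 1) :
    BSDp W p := by
  haveI : Finite W.toAffine.Point := finite_point_of_analyticRank_eq_zero W hGZK hr
  have hirr : Irr W p :=
    hasIrreducibleModPGaloisRep_of_hasSurjectiveModNGaloisRep W p (by simpa using hsurj 1)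
  have hrank' : Module.finrank ℚ ℚ + 1 ≤ W'.mordellWeilRank := by rwa [Module.finrank_self]
  have hvis := W.exists_sha_ne_zero_of_congr_of_rank W' hp θ hθ S hS ‹_›
    (coprime_natCard_point_of_irr W p hirr) hrank' hloc
  have hlow : MissingLowerBoundAt W p :=
    missingLowerBoundAt_of_casselsTate_of_pow_dvd W p hCT (hGZK W (by omega)).2 hq (k := 1)
      (by simpa using hv) (by simpa using dvd_shaOrder_of_exists_torsion W p hvis)
  exact X4RankZero.bsdp_of_missingLowerBoundAt_of_katoSharp_of_casselsTate_of_tamDefect_le_one W p hCT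
    hKatoS hGZK hmod hr hX hpot hsurj htam D hc hq hev hlow

/-! ### §2. The same two ENDs over the places of a prime list (n1011-p18's adapter shape) -/

/-- **`X4RankZero.bsdp_of_congr_of_rank_two_of_katoSharp` with `S` = the places over a list of
rational primes `L ∋ p`** supporting both integral discriminants (outside: both good, the place does not
divide `p` — Silverman VII.5.1 (a)); `hloc` is asked per prime of `L`. n1011-p18's
`…_of_kato_of_primeList` binder order token for token with `hKato ↦ hKatoS` and `htam` retyped.
[cite: SilvermanAEC2009, VII.5 Prop. 5.1(a)] [cite: Kato2004Asterisque, Thm. 14.5 (3) (p. 236), Prop. 14.16 (2) (p. 244)] -/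
theorem X4RankZero.bsdp_of_congr_of_rank_two_of_katoSharp_of_primeList
    (hKatoS : Kato2004.rankZero_padicValNat_sha_le_sub_localTamagawa_of_additive_potGood_of_imageContainsSL2)
    (hCT : exists_casselsTate_pairing (K := ℚ))
    (hGZK : rank_eq_analyticRank_of_analyticRank_le_one) (hmod : hasEntireLFunction_rat)
    (W : WeierstrassCurve ℚ) [W.IsElliptic] [W.IsGloballyMinimal] (p : ℕ) [Fact p.Prime] (hp : p ≠ 2)
    (hr : W.analyticRank = 0) (hX : ClassX4 W p) (hpot : 0 ≤ padicValRat p W.j)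
    (hsurj : ∀ n : ℕ, W.HasSurjectiveModNGaloisRep (p ^ n : ℕ))
    (htam : padicValNat p W.tamagawaProduct =
      padicValNat p ((W.baseChange ℚ_[p]).localTamagawaNumber ℤ_[p]))
    {N : ℕ} [NeZero N] (D : ModularParametrizationData W N) (hc : ¬ (p : ℤ) ∣ D.maninConstant)
    {q : ℚ} (hq : shaAn W = (q : ℂ)) (hv : padicValRat p q ≤ 2)
    (W' : WeierstrassCurve ℚ) [W'.IsElliptic]
    (θ : geomTorsion W' (p : ℤ) ≃+ geomTorsion W (p : ℤ))
    (hθ : ∀ (σ : Field.absoluteGaloisGroup ℚ) (P : geomTorsion W' (p : ℤ)), θ (σ • P) = σ • θ P)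
    (hrank : 2 ≤ W'.mordellWeilRank)
    {E₀ F₀ : WeierstrassCurve ℤ} (hE : E₀.map (Int.castRingHom ℚ) = W)
    (hF : F₀.map (Int.castRingHom ℚ) = W') (L : List ℕ) (hpL : p ∈ L)
    (hΔE : ∀ q : ℕ, q.Prime → (q : ℤ) ∣ E₀.Δ → q ∈ L)
    (hΔF : ∀ q : ℕ, q.Prime → (q : ℤ) ∣ F₀.Δ → q ∈ L)
    (hloc : ∀ v : HeightOneSpectrum (𝓞 ℚ), (primesEquiv v : ℕ) ∈ L →
      Nat.card (nsmulAddMonoidHom p :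
        (W'.baseChange (v.adicCompletion ℚ)).toAffine.Point →+ _).ker = 1) :
    BSDp W p := by
  obtain ⟨S, hS⟩ := exists_placeFinset_of_primeList L
  exact X4RankZero.bsdp_of_congr_of_rank_two_of_katoSharp hKatoS hCT hGZK hmod W p hp hr hX hpot hsurj
    htam D hc hq hv W' θ hθ hrank S
    (good_and_not_mem_of_not_mem_placeFinset hE hF L (Fact.out : p.Prime) hpL hΔE hΔF hS)
    (fun v hvS ↦ hloc v ((hS v).mp hvS))

/-- **`X4RankZero.bsdp_of_congr_of_rank_two_of_katoSharp_of_tamDefect_le_one` with `S` = the places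
over a list of rational primes `L ∋ p`** (as the previous adapter, `hev` inserted after `hv`).
[cite: SilvermanAEC2009, VII.5 Prop. 5.1(a)] [cite: Kato2004Asterisque, Thm. 14.5 (3) (p. 236), Prop. 14.16 (2) (p. 244)]
[cite: SilvermanAEC2009, Thm. X.4.14] -/
theorem X4RankZero.bsdp_of_congr_of_rank_two_of_katoSharp_of_tamDefect_le_one_of_primeList
    (hKatoS : Kato2004.rankZero_padicValNat_sha_le_sub_localTamagawa_of_additive_potGood_of_imageContainsSL2)
    (hCT : exists_casselsTate_pairing (K := ℚ))
    (hGZK : rank_eq_analyticRank_of_analyticRank_le_one) (hmod : hasEntireLFunction_rat)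
    (W : WeierstrassCurve ℚ) [W.IsElliptic] [W.IsGloballyMinimal] (p : ℕ) [Fact p.Prime] (hp : p ≠ 2)
    (hr : W.analyticRank = 0) (hX : ClassX4 W p) (hpot : 0 ≤ padicValRat p W.j)
    (hsurj : ∀ n : ℕ, W.HasSurjectiveModNGaloisRep (p ^ n : ℕ))
    (htam : padicValNat p W.tamagawaProduct ≤
      padicValNat p ((W.baseChange ℚ_[p]).localTamagawaNumber ℤ_[p]) + 1)
    {N : ℕ} [NeZero N] (D : ModularParametrizationData W N) (hc : ¬ (p : ℤ) ∣ D.maninConstant)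
    {q : ℚ} (hq : shaAn W = (q : ℂ)) (hv : padicValRat p q ≤ 2) (hev : Even (padicValRat p q))
    (W' : WeierstrassCurve ℚ) [W'.IsElliptic]
    (θ : geomTorsion W' (p : ℤ) ≃+ geomTorsion W (p : ℤ))
    (hθ : ∀ (σ : Field.absoluteGaloisGroup ℚ) (P : geomTorsion W' (p : ℤ)), θ (σ • P) = σ • θ P)
    (hrank : 2 ≤ W'.mordellWeilRank)
    {E₀ F₀ : WeierstrassCurve ℤ} (hE : E₀.map (Int.castRingHom ℚ) = W)
    (hF : F₀.map (Int.castRingHom ℚ) = W') (L : List ℕ) (hpL : p ∈ L)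
    (hΔE : ∀ q : ℕ, q.Prime → (q : ℤ) ∣ E₀.Δ → q ∈ L)
    (hΔF : ∀ q : ℕ, q.Prime → (q : ℤ) ∣ F₀.Δ → q ∈ L)
    (hloc : ∀ v : HeightOneSpectrum (𝓞 ℚ), (primesEquiv v : ℕ) ∈ L →
      Nat.card (nsmulAddMonoidHom p :
        (W'.baseChange (v.adicCompletion ℚ)).toAffine.Point →+ _).ker = 1) :
    BSDp W p := by
  obtain ⟨S, hS⟩ := exists_placeFinset_of_primeList L
  exact X4RankZero.bsdp_of_congr_of_rank_two_of_katoSharp_of_tamDefect_le_one hKatoS hCT hGZK hmod W p hp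
    hr hX hpot hsurj htam D hc hq hv hev W' θ hθ hrank S
    (good_and_not_mem_of_not_mem_placeFinset hE hF L (Fact.out : p.Prime) hpL hΔE hΔF hS)
    (fun v hvS ↦ hloc v ((hS v).mp hvS))

end Summit.BirchSwinnertonDyer.Rank1Residual.Additive

end
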